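import Literature.MathematicalPhysics.QuantumFieldTheory.Balaban1983to89.B9B8KnitLetterMajorantTransfer

/-!
# `Balaban1983to89.B9B8KnitLetterEntriesTransfer` — [B9] THM 3.1 (3.42)₂,₄ AT THE KNIT LETTER FROM THE SAME ENTRIES AT def-Y's LETTER: for ANY
# real-coordinate left factor `D` (print's `∇_U`, `Δ_U` realified), the block majorant `A₁·W(y)·e^{−δ₀d}` of `D·conj b(η²G′(U; parSymY))` passes to
# `D·conj b(η²G′(U; parKnitY))` as `A₁(1 + c₁(α)·θc₁(α)(1 − θc₁(α))⁻¹)·W(y)·e^{−(1−α)δ₀d}` (junction J-B file 10 — the weighted-gradient half of (E12) at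
# print's own transporters, INHERITED from M5.5 FILE 2 in its `Eb * conj b (η²•G)` currency)

statement-level skeleton of published theorems with citation tags; proofs where landed; nothing here is a claim about the
Yang–Mills mass gap

T. Bałaban, *Propagators for lattice gauge theories in a background field*, Commun. Math. Phys. **99** (1985) 389–434 [`Balaban1985BackgroundPropagators`,
"[B9]"]; T. Bałaban, *Propagators and renormalization transformations for lattice gauge theories. II*, Commun. Math. Phys. **96** (1984) 223–250
[`Balaban1984PropagatorsII`, "[4]"]; T. Bałaban, *Averaging operations for lattice gauge theories*, Commun. Math. Phys. **98** (1985) 17–51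
[`Balaban1985Averaging`, "[B7]"]; T. Bałaban, *Spaces of regular gauge field configurations on a lattice and gauge fixing conditions*, Commun. Math. Phys.
**99** (1985) 75–102 [`Balaban1985RegularSpaces`, "[B8]"].

THE PRINT.  [B9] Thm 3.1 (3.42) p. 397: *«|(G′(U)λ)(x)|, |(∇_U G′(U)λ)(x)|, |(G′(U)∇*_U λ)(x)|, |(Δ_U G′(U)λ)(x)| ≦ B₀[(Lʲη)², Lʲη, Lʲη, 1]e^{−δ₀d(y,y′)}|λ|»*
at the averaging operators (3.19) p. 393 with the composite contours *«(52), (53) in [5]»* (the knit letter); [B9] p. 409–410 (3.90) ∕ [4] p. 234 (2.67):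
*«The expansion is convergent in all norms appearing in the inequalities (3.42)–(3.47)»*, *«The similar inequalities hold for a derivative of G′λ … with
(Lʲη)² replaced by Lʲη»*.  [B8] (1.101) p. 93: the consumer's (E12) reads the first two entries.

WHY THIS FILE ∕ THE ARGUMENT.  File 8's first resolvent identity `G′_knit = G′_sym + G′_sym∘E∘G′_knit` gives, for any left factor `D` on the real
coordinates, the DIRECT formula `D·conj b(η²G′_knit) = D·conj b(η²G′_sym) + [D·conj b(η²G′_sym)]·[conj b(η⁻²E)·conj b(η²G′_knit)]` — no second Neumann
series: the last bracket is KNOWN (file 9 §1: `conj b(η⁻²E)` block-diagonal of size `κ₀ = η⁻²·32(d+1)²α₀′L^{−2k}·M₂Σ‖b_j‖`; file 9 §2: the majorant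
`A·c₁(1 − θc₁)⁻¹·P·e^{−(1−α)δ₀d}` of `conj b(η²G′_knit)`), so it has the majorant `r·e^{−(1−α)δ₀d}` with `r = θc₁(1 − θc₁)⁻¹` (`θ = κ₀·A·P_max`), and
[4] (2.61) + (2.54) compose it with the displayed `A₁W(y)e^{−δ₀d}` (`B6RandomWalk.majorant_G0_mul_265`, one factor `c₁(α)`).

CITATION HEADER (lean-in-tree rule).  Cell `lit-balaban`, sub-row G-B9-LETTERS, junction J-B (lead RULINGS #3–#4; RULING #4 (ii)) file 10 → seat `lit-balaban-p33`
gen 94.  REUSED BY NAME: r03∕p21-lineage `B6RandomWalk.majorant_G0_mul_265`, `hasMajorant_mul`, `hasMajorant_add`, `hasMajorant_mono`; p21's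
`B9Eq352DivFormLetters.conj`∕`conj_mul` (M5.5 FILE 2 `B9Thm37GpTorusRegularEntries.hasMajorant_left_conj_Gp_of_cubes` produces this file's displayed
hypothesis `hD`); junction files 8 (`GpY_parKnitY_eq`), 9 (`hasMajorant_conj_smul_sub`, `sum_ite_eq_mul`, `hasMajorant_conj_GpY_parKnitY_of_parSymY`,
`inv_etaS_sq_mul`, `geo9K_len_sq_le_one`), 4b (`parKnitY_mem_of_pdev`).

WHAT THIS FILE PROVES (sorry-free; no definitions; the majorants at def-Y's letter are DISPLAYED HYPOTHESES, nothing of [B9] asserted).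
* §1 `left_conj_identity` (the direct formula above, `G`-valued `U` and knit legs, `G ≤ U(N)`, `η ≠ 0`).
* §2 ★★★ **`hasMajorant_left_conj_GpY_parKnitY_of_parSymY`**: class (52) hypotheses as files 8–9; real basis `b` with `|b.repr v j| ≤ M₂‖v‖`; geometry inputs
  (2.54), `d(y,y) = 0`, `d ≥ 0`, (2.61), (2.63) at `(δ₀, α)` with `0 ≤ (1−α)δ₀`, `0 ≤ αδ₀`; `0 ≤ A`, `0 ≤ P ≤ P_max`; `0 ≤ A₁`, `0 ≤ W`; a real-coordinate left
  factor `D`; DISPLAYED majorants `A·P·e^{−δ₀d}` of `conj b(η²G′_sym)` and `A₁·W·e^{−δ₀d}` of `D·conj b(η²G′_sym)`; `θ = (η²)⁻¹·32(d+1)²α₀′(L^k)⁻²·(M₂Σ‖b_j‖)·A·P_max`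
  with `θc₁(α) < 1`  ⟹  `D·conj b(η²G′(U; parKnitY))` has the majorant `A₁·(1 + c₁(α)·θc₁(α)(1 − θc₁(α))⁻¹)·W(y)·e^{−(1−α)δ₀d(y,y′)}`.
* §3 ★★★ **`hasMajorant_left_conj_GpY_parKnitY_of_parSymY_len`**: print's units `η = etaS i`, `c_f = L^k`, `P = ℓ²` (`P_max = 1`), `θ = 32(d+1)²α₀′·(M₂Σ‖b_j‖)·A`.

HONEST SCOPE.  A transfer under displayed hypotheses (suppliers: M5.5 FILES 1–2 at def-Y's letter); constants explicit; the RIGHT entry (3.42)₃ (`G′∇*_U`,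
a right factor) is not transferred here (it needs the column form of (2.61), i.e. the symmetry of `d`); the (52) hypothesis on the lift is carried
explicitly.  Count-neutral; nothing continuum, nothing about OS axioms or the mass gap.  No `sorry`, no `axiom`, no `instance`, no `notation`.  NEW file;
nothing landed is modified.  Net new unproved facts: 0.  Seat `lit-balaban-p33` gen 94, 2026-08-28.
-/

noncomputable section

namespace Literature.MathematicalPhysics.QuantumFieldTheory.Balaban1983to89.B9B8KnitLetterEntriesTransfer

open Node00 B6KLevelCensusIndexV1 B6Geom246MultiLevelBox B9BackgroundsKLevelV1 B9Eq39Adjoint B9Thm311ReadingCoords B9Thm311DeltaPrimePos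
open B6RandomWalk (HasMajorant Triangle254 Ineq261 Ineq263 hasMajorant_mono hasMajorant_mul hasMajorant_add majorant_G0_mul_265 c1_nonneg)
open B9Thm34Ext (toB6 toB6_dist)
open B9GeoNormsKLevelV1 (geo9K)
open B9Eq352DivFormLetters (coordEquiv conj conj_apply)
open B9Ineq349SiteComposite (etaS_pos)
open B7Prop2Explicit (AvgClosed pdev C0 c2')
open B9B8CarrierDictionary (liftCfg)
open B9B8AveragingJunction (parKnitY parKnitY_inv)
open B9B8KnitLetterRegular (parKnitY_mem_of_pdev)
open B9B8KnitLetterResolvent (GpY_parKnitY_eq)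
open B9B8KnitLetterMajorantTransfer (hasMajorant_conj_smul_sub sum_ite_eq_mul hasMajorant_conj_GpY_parKnitY_of_parSymY inv_etaS_sq_mul geo9K_len_sq_le_one)
open scoped Matrix Matrix.Norms.L2Operator

variable {d ℓ : ℕ} {hd : 1 ≤ d + 1} {hL : Odd (ℓ + 1) ∧ 1 < ℓ + 1} {b₀ b₁ : ℝ}
variable (i : KIdx d ℓ hd hL b₀ b₁) {N : ℕ} {G : Subgroup (Matrix (Fin N) (Fin N) ℂ)ˣ}
variable {ι : Type} [Fintype ι] [DecidableEq ι] (b : Module.Basis ι ℝ (Matrix (Fin N) (Fin N) ℂ))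
variable [Fintype (geo9K i).Site] [DecidableEq (geo9K i).Site] {Rr : ℝ} {Hp : Prop} (ιB : BlkY i → IBondY i)

/-! ## §1 The direct formula for a left factor -/

omit [DecidableEq ι] [Fintype (geo9K i).Site] [DecidableEq (geo9K i).Site] in
/-- THE DIRECT FORMULA FOR LEFT ENTRIES: with `E = Δ′_sym − Δ′_knit`, `η ≠ 0` and any real-coordinate left factor `D`,
`D·conj b(η²G′_knit) = D·conj b(η²G′_sym) + (D·conj b(η²G′_sym))·(conj b(η⁻²E)·conj b(η²G′_knit))` (`G`-valued `U` and knit legs, `G ≤ U(N)`).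
[cite: Balaban1984PropagatorsII, (2.50)–(2.52) p.232, (2.67) p.234; Balaban1985BackgroundPropagators, (3.90) p.409] -/
theorem left_conj_identity (hG : G ≤ B7Prop2Explicit.unitaryUnits (Matrix (Fin N) (Fin N) ℂ)) {U : CfgY (Matrix (Fin N) (Fin N) ℂ) i}
    (hU : ∀ μ x, U μ x ∈ G) (hpar : ∀ z w : SiteY i, parKnitY i U z w ∈ G) {η : ℝ} (hη : η ≠ 0) (D : Module.End ℝ (SiteY i × ι → ℝ)) :
    D * conj b ((η ^ 2) • (GpY i (parKnitY i) U).restrictScalars ℝ)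
      = D * conj b ((η ^ 2) • (GpY i (parSymY i) U).restrictScalars ℝ)
        + D * conj b ((η ^ 2) • (GpY i (parSymY i) U).restrictScalars ℝ)
          * (conj b ((η ^ 2)⁻¹ • (deltaPrimeAY i (parSymY i) U - deltaPrimeAY i (parKnitY i) U).restrictScalars ℝ)
            * conj b ((η ^ 2) • (GpY i (parKnitY i) U).restrictScalars ℝ)) := by
  set Gk : Module.End ℝ (SiteY i → Matrix (Fin N) (Fin N) ℂ) := (GpY i (parKnitY i) U).restrictScalars ℝ with hGk
  set Gs : Module.End ℝ (SiteY i → Matrix (Fin N) (Fin N) ℂ) := (GpY i (parSymY i) U).restrictScalars ℝ with hGs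
  set E : Module.End ℝ (SiteY i → Matrix (Fin N) (Fin N) ℂ) := (deltaPrimeAY i (parSymY i) U - deltaPrimeAY i (parKnitY i) U).restrictScalars ℝ with hE
  have hη2 : (η ^ 2 : ℝ) ≠ 0 := pow_ne_zero 2 hη
  have hfixℝ : Gk = Gs + Gs * E * Gk := congrArg (LinearMap.restrictScalars ℝ) (GpY_parKnitY_eq i hG hU hpar)
  have hprod : ((η ^ 2)⁻¹ • E) * ((η ^ 2) • Gk) = E * Gk := by
    rw [smul_mul_assoc, mul_smul_comm, smul_smul, inv_mul_cancel₀ hη2, one_smul]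
  have key : (η ^ 2) • Gk = (η ^ 2) • Gs + ((η ^ 2) • Gs) * (((η ^ 2)⁻¹ • E) * ((η ^ 2) • Gk)) := by
    rw [hprod, smul_mul_assoc, ← mul_assoc, ← smul_add]
    exact congrArg ((η ^ 2) • ·) hfixℝ
  have hadd : ∀ T₁ T₂ : Module.End ℝ (SiteY i → Matrix (Fin N) (Fin N) ℂ), conj b (T₁ + T₂) = conj b T₁ + conj b T₂ := fun T₁ T₂ => by
    simp only [B9Eq352DivFormLetters.conj, map_add]
  have hconj : conj b ((η ^ 2) • Gk) = conj b ((η ^ 2) • Gs) + conj b ((η ^ 2) • Gs) * (conj b ((η ^ 2)⁻¹ • E) * conj b ((η ^ 2) • Gk)) := by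
    conv_lhs => rw [key]
    rw [hadd, B9Eq352DivFormLetters.conj_mul, B9Eq352DivFormLetters.conj_mul]
  conv_lhs => rw [hconj]
  rw [mul_add, ← mul_assoc]

/-! ## §2 The transfer of a left entry -/

/-- ★★★ **[B9] THM 3.1 (3.42)₂,₄ AT THE KNIT LETTER, FROM THE SAME ENTRY AT def-Y's LETTER OF RECORD.**  Hypotheses: the class (52) data of files 8–9
(`G ≤ U(N)` averaging-closed, `N ≥ 1`, `G`-valued `U`, `pdev (liftCfg U) < α₀′(L^k)⁻²`, `0 < α₀′`, `C₀α₀′ ≤ ⅓`, `2α₀′ ≤ c₂′`); a real basis `b` of `M_N(ℂ)` with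
`|b.repr v j| ≤ M₂‖v‖`; the member's geometry inputs at `(δ₀, α)` with `0 ≤ (1−α)δ₀`, `0 ≤ αδ₀`; weights `0 ≤ A`, `0 ≤ P ≤ P_max`, `0 ≤ A₁`, `0 ≤ W`; `η ≠ 0`;
a real-coordinate LEFT FACTOR `D`; the DISPLAYED block majorants `A·P(y)·e^{−δ₀d}` of `conj b(η²G′(U; parSymY))` and `A₁·W(y)·e^{−δ₀d}` of
`D·conj b(η²G′(U; parSymY))`; `θ = (η²)⁻¹·32(d+1)²α₀′(L^k)⁻²·(M₂Σ_j‖b_j‖)·A·P_max` with `θc₁(α) < 1`.  THEN `D·conj b(η²G′(U; parKnitY))` has the block majorant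
`A₁·(1 + c₁(α)·(θc₁(α)·(1 − θc₁(α))⁻¹))·W(y)·e^{−(1−α)δ₀d(y,y′)}` — print's «(Lʲη)² replaced by Lʲη» entries at its own transporters.
[cite: Balaban1985BackgroundPropagators, Thm 3.1 (3.42) p.397, (3.19) p.393, Thm 3.7 (3.90) pp.409–410; Balaban1984PropagatorsII, Prop. 2.2 (2.51) p.232, (2.61) p.234, (2.66)–(2.67) p.234; Balaban1985Averaging, (52)–(53) pp.26–27] -/
theorem hasMajorant_left_conj_GpY_parKnitY_of_parSymY [Nonempty (Fin N)] (hG : G ≤ B7Prop2Explicit.unitaryUnits (Matrix (Fin N) (Fin N) ℂ))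
    (hGa : AvgClosed (d + 1) (ℓ + 1) G) {U : CfgY (Matrix (Fin N) (Fin N) ℂ) i} (hU : ∀ μ x, U μ x ∈ G)
    {α₀' : ℝ} (hα : 0 < α₀') (hα3 : C0 (d + 1) * α₀' ≤ 1 / 3) (hα2 : 2 * α₀' ≤ c2' (d + 1) (ℓ + 1))
    (h52 : pdev (liftCfg U) < α₀' * ((((ℓ + 1 : ℕ) : ℝ) ^ i.k)⁻¹) ^ 2)
    {M₂ : ℝ} (hM₂ : 0 ≤ M₂) (hrepr : ∀ (v : Matrix (Fin N) (Fin N) ℂ) (j : ι), |b.repr v j| ≤ M₂ * ‖v‖)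
    (d' : ℕ) {δ₀ α A Pmax A₁ : ℝ} {P W : (geo9K i).Site → ℝ} (hA : 0 ≤ A) (hP : ∀ y, 0 ≤ P y) (hPmax : ∀ y, P y ≤ Pmax)
    (hA₁ : 0 ≤ A₁) (hW : ∀ y, 0 ≤ W y) (hαδ : 0 ≤ (1 - α) * δ₀) (hαδ' : 0 ≤ α * δ₀)
    (htri : Triangle254 (toB6 (geo9K i) Rr Hp)) (hrefl : ∀ y : (geo9K i).Site, (geo9K i).dist y y = 0)
    (hdnn : ∀ y y' : (geo9K i).Site, 0 ≤ (geo9K i).dist y y')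
    (h261 : Ineq261 d' (toB6 (geo9K i) Rr Hp) δ₀ α) (h263 : Ineq263 d' (toB6 (geo9K i) Rr Hp) δ₀ α)
    {η : ℝ} (hη : η ≠ 0) {θ : ℝ}
    (hθ : θ = (η ^ 2)⁻¹ * (32 * ((d : ℝ) + 1) ^ 2 * α₀' * (((((ℓ + 1) ^ i.k : ℕ) : ℝ)) ^ 2)⁻¹) * (M₂ * ∑ j, ‖b j‖) * A * Pmax)
    (hsmall : θ * B6.c1 d' δ₀ α < 1) (D : Module.End ℝ (SiteY i × ι → ℝ))
    (hGs : HasMajorant (g := toB6 (geo9K i) Rr Hp) (fun p : SiteY i × ι => ιB (blkOf i.D.toDomains p.1))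
      (conj b ((η ^ 2) • (GpY i (parSymY i) U).restrictScalars ℝ))
      (fun a a' => A * P a * Real.exp (-(δ₀ * (geo9K i).dist a a'))))
    (hD : HasMajorant (g := toB6 (geo9K i) Rr Hp) (fun p : SiteY i × ι => ιB (blkOf i.D.toDomains p.1))
      (D * conj b ((η ^ 2) • (GpY i (parSymY i) U).restrictScalars ℝ))
      (fun a a' => A₁ * W a * Real.exp (-(δ₀ * (geo9K i).dist a a')))) :
    HasMajorant (g := toB6 (geo9K i) Rr Hp) (fun p : SiteY i × ι => ιB (blkOf i.D.toDomains p.1))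
      (D * conj b ((η ^ 2) • (GpY i (parKnitY i) U).restrictScalars ℝ))
      (fun a a' => A₁ * (1 + B6.c1 d' δ₀ α * (θ * B6.c1 d' δ₀ α * (1 - θ * B6.c1 d' δ₀ α)⁻¹)) * W a
        * Real.exp (-((1 - α) * δ₀ * (geo9K i).dist a a'))) := by
  have hparK : ∀ z w : SiteY i, parKnitY i U z w ∈ G := fun z w => parKnitY_mem_of_pdev i hGa hU hα hα3 hα2 h52 z w
  set ε : ℝ := 32 * ((d : ℝ) + 1) ^ 2 * α₀' * (((((ℓ + 1) ^ i.k : ℕ) : ℝ)) ^ 2)⁻¹ with hεdef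
  set κ₀ : ℝ := (η ^ 2)⁻¹ * ε * (M₂ * ∑ j, ‖b j‖) with hκ₀def
  set c₁ : ℝ := B6.c1 d' δ₀ α with hc₁def
  have hε0 : 0 ≤ ε := by positivity
  have hSb : 0 ≤ ∑ j, ‖b j‖ := Finset.sum_nonneg fun _ _ => norm_nonneg _
  have hκ₀0 : 0 ≤ κ₀ := by positivity
  have hc₁0 : 0 ≤ c₁ := c1_nonneg d' δ₀ α
  have hPmax0 : 0 ≤ Pmax := le_trans (hP (ιB (blkOf i.D.toDomains (toKT i).origin))) (hPmax _)
  have hθ0 : 0 ≤ θ := by rw [hθ]; positivity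
  have hq0 : 0 ≤ (1 - θ * c₁)⁻¹ := inv_nonneg.2 (by rw [hc₁def]; linarith)
  -- file 9: the majorant of `conj b(η²G′_knit)`
  have hGk := hasMajorant_conj_GpY_parKnitY_of_parSymY i b ιB hG hGa hU hα hα3 hα2 h52 hM₂ hrepr d' hA hP hPmax hαδ htri hrefl hdnn h261 h263 hη
    (by rw [← hθ]; exact hsmall) hGs
  rw [← hθ] at hGk
  -- the known bracket `T = conj b(η⁻²E)·conj b(η²G′_knit)` has the majorant `r·e^{−(1−α)δ₀d}`, `r = θc₁(1 − θc₁)⁻¹`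
  set r : ℝ := θ * c₁ * (1 - θ * c₁)⁻¹ with hrdef
  have hr0 : 0 ≤ r := by positivity
  have hEmaj := hasMajorant_conj_smul_sub i b ιB (Rr := Rr) (Hp := Hp) hG hGa hU hα hα3 hα2 h52 hM₂ hrepr ((η ^ 2)⁻¹)
  have habs : |(η ^ 2)⁻¹| = (η ^ 2)⁻¹ := abs_of_nonneg (inv_nonneg.2 (sq_nonneg η))
  have hK₂ : ∀ a a' : (geo9K i).Site, 0 ≤ A * B6.c1 d' δ₀ α * (1 - θ * B6.c1 d' δ₀ α)⁻¹ * P a * Real.exp (-((1 - α) * δ₀ * (geo9K i).dist a a')) :=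
    fun a a' => mul_nonneg (mul_nonneg (mul_nonneg (mul_nonneg hA hc₁0) hq0) (hP a)) (Real.exp_nonneg _)
  have hT : HasMajorant (g := toB6 (geo9K i) Rr Hp) (fun p : SiteY i × ι => ιB (blkOf i.D.toDomains p.1))
      (conj b ((η ^ 2)⁻¹ • (deltaPrimeAY i (parSymY i) U - deltaPrimeAY i (parKnitY i) U).restrictScalars ℝ)
        * conj b ((η ^ 2) • (GpY i (parKnitY i) U).restrictScalars ℝ))
      (fun a a' => r * Real.exp (-((1 - α) * δ₀ * (geo9K i).dist a a'))) := by
    refine hasMajorant_mono _ (hasMajorant_mul _ hEmaj hGk hK₂) fun a a' => ?_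
    have hsum := sum_ite_eq_mul (S := (geo9K i).Site) a (|(η ^ 2)⁻¹| * ε * (M₂ * ∑ j, ‖b j‖))
      (fun y'' => A * B6.c1 d' δ₀ α * (1 - θ * B6.c1 d' δ₀ α)⁻¹ * P y'' * Real.exp (-((1 - α) * δ₀ * (geo9K i).dist y'' a')))
    refine (le_of_eq hsum).trans ?_
    rw [habs]
    have he : 0 ≤ Real.exp (-((1 - α) * δ₀ * (geo9K i).dist a a')) := Real.exp_nonneg _
    have hPa := hPmax a
    have e1 : r = κ₀ * (A * c₁ * (1 - θ * c₁)⁻¹ * Pmax) := by rw [hrdef, hθ, hκ₀def]; ring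
    calc κ₀ * (A * B6.c1 d' δ₀ α * (1 - θ * B6.c1 d' δ₀ α)⁻¹ * P a * Real.exp (-((1 - α) * δ₀ * (geo9K i).dist a a')))
        ≤ κ₀ * (A * c₁ * (1 - θ * c₁)⁻¹ * Pmax * Real.exp (-((1 - α) * δ₀ * (geo9K i).dist a a'))) :=
          mul_le_mul_of_nonneg_left (mul_le_mul_of_nonneg_right (mul_le_mul_of_nonneg_left hPa (mul_nonneg (mul_nonneg hA hc₁0) hq0)) he) hκ₀0
      _ = r * Real.exp (-((1 - α) * δ₀ * (geo9K i).dist a a')) := by rw [e1]; ring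
  -- compose with the displayed left entry ([4] (2.61) + (2.54): one factor `c₁`)
  have hDT := majorant_G0_mul_265 (g := toB6 (geo9K i) Rr Hp) (fun p : SiteY i × ι => ιB (blkOf i.D.toDomains p.1)) d' δ₀ α A₁ r W hA₁ hW hr0 hαδ
    htri h261 hD hT
  -- the displayed entry itself at the degraded rate
  have hD' : HasMajorant (g := toB6 (geo9K i) Rr Hp) (fun p : SiteY i × ι => ιB (blkOf i.D.toDomains p.1))
      (D * conj b ((η ^ 2) • (GpY i (parSymY i) U).restrictScalars ℝ))
      (fun a a' => A₁ * W a * Real.exp (-((1 - α) * δ₀ * (geo9K i).dist a a'))) := by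
    refine hasMajorant_mono _ hD fun a a' => mul_le_mul_of_nonneg_left (Real.exp_le_exp.2 ?_) (mul_nonneg hA₁ (hW a))
    have := mul_nonneg hαδ' (hdnn a a')
    nlinarith
  have hsum := hasMajorant_add _ hD' hDT
  rw [left_conj_identity i b hG hU hparK hη D]
  refine hasMajorant_mono _ hsum fun a a' => le_of_eq ?_
  simp only [hc₁def, toB6_dist]
  ring

/-! ## §3 Print's units -/

/-- ★★★ **(3.42)₂,₄ AT THE KNIT LETTER IN PRINT's UNITS** (`η = etaS i = L^{−k}`, `c_f = L^k`, `P = ℓ²`): under the hypotheses of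
`hasMajorant_left_conj_GpY_parKnitY_of_parSymY` with the displayed majorants `A·ℓ(y)²·e^{−δ₀d}` of `conj b(η²G′(U; parSymY))` (M5.5 FILE 1's output shape) and
`A₁·W(y)·e^{−δ₀d}` of `D·conj b(η²G′(U; parSymY))` (M5.5 FILE 2's `hasMajorant_left_conj_Gp_of_cubes` output shape), and `θ = 32(d+1)²α₀′·(M₂Σ‖b_j‖)·A`,
`θc₁(α) < 1`:  `D·conj b(η²G′(U; parKnitY))` has the majorant `A₁·(1 + c₁(α)·θc₁(α)(1 − θc₁(α))⁻¹)·W(y)·e^{−(1−α)δ₀d(y,y′)}`.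
[cite: Balaban1985BackgroundPropagators, Thm 3.1 (3.42) p.397, (3.19) p.393, (3.90) pp.409–410; Balaban1984PropagatorsII, (2.66)–(2.67) p.234; Balaban1985RegularSpaces, (1.101) p.93] -/
theorem hasMajorant_left_conj_GpY_parKnitY_of_parSymY_len [Nonempty (Fin N)] (hG : G ≤ B7Prop2Explicit.unitaryUnits (Matrix (Fin N) (Fin N) ℂ))
    (hGa : AvgClosed (d + 1) (ℓ + 1) G) {U : CfgY (Matrix (Fin N) (Fin N) ℂ) i} (hU : ∀ μ x, U μ x ∈ G)
    {α₀' : ℝ} (hα : 0 < α₀') (hα3 : C0 (d + 1) * α₀' ≤ 1 / 3) (hα2 : 2 * α₀' ≤ c2' (d + 1) (ℓ + 1))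
    (h52 : pdev (liftCfg U) < α₀' * ((((ℓ + 1 : ℕ) : ℝ) ^ i.k)⁻¹) ^ 2) (hcf : i.cf = (((ℓ + 1 : ℕ) : ℝ)) ^ i.k)
    {M₂ : ℝ} (hM₂ : 0 ≤ M₂) (hrepr : ∀ (v : Matrix (Fin N) (Fin N) ℂ) (j : ι), |b.repr v j| ≤ M₂ * ‖v‖)
    (d' : ℕ) {δ₀ α A A₁ : ℝ} {W : (geo9K i).Site → ℝ} (hA : 0 ≤ A) (hA₁ : 0 ≤ A₁) (hW : ∀ y, 0 ≤ W y) (hαδ : 0 ≤ (1 - α) * δ₀)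
    (hαδ' : 0 ≤ α * δ₀) (htri : Triangle254 (toB6 (geo9K i) Rr Hp)) (hrefl : ∀ y : (geo9K i).Site, (geo9K i).dist y y = 0)
    (hdnn : ∀ y y' : (geo9K i).Site, 0 ≤ (geo9K i).dist y y')
    (h261 : Ineq261 d' (toB6 (geo9K i) Rr Hp) δ₀ α) (h263 : Ineq263 d' (toB6 (geo9K i) Rr Hp) δ₀ α)
    {θ : ℝ} (hθ : θ = 32 * ((d : ℝ) + 1) ^ 2 * α₀' * (M₂ * ∑ j, ‖b j‖) * A) (hsmall : θ * B6.c1 d' δ₀ α < 1)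
    (D : Module.End ℝ (SiteY i × ι → ℝ))
    (hGs : HasMajorant (g := toB6 (geo9K i) Rr Hp) (fun p : SiteY i × ι => ιB (blkOf i.D.toDomains p.1))
      (conj b ((etaS i ^ 2) • (GpY i (parSymY i) U).restrictScalars ℝ))
      (fun a a' => A * (geo9K i).len a ^ 2 * Real.exp (-(δ₀ * (geo9K i).dist a a'))))
    (hD : HasMajorant (g := toB6 (geo9K i) Rr Hp) (fun p : SiteY i × ι => ιB (blkOf i.D.toDomains p.1))
      (D * conj b ((etaS i ^ 2) • (GpY i (parSymY i) U).restrictScalars ℝ))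
      (fun a a' => A₁ * W a * Real.exp (-(δ₀ * (geo9K i).dist a a')))) :
    HasMajorant (g := toB6 (geo9K i) Rr Hp) (fun p : SiteY i × ι => ιB (blkOf i.D.toDomains p.1))
      (D * conj b ((etaS i ^ 2) • (GpY i (parKnitY i) U).restrictScalars ℝ))
      (fun a a' => A₁ * (1 + B6.c1 d' δ₀ α * (θ * B6.c1 d' δ₀ α * (1 - θ * B6.c1 d' δ₀ α)⁻¹)) * W a
        * Real.exp (-((1 - α) * δ₀ * (geo9K i).dist a a'))) := by
  have hθ' : θ = (etaS i ^ 2)⁻¹ * (32 * ((d : ℝ) + 1) ^ 2 * α₀' * (((((ℓ + 1) ^ i.k : ℕ) : ℝ)) ^ 2)⁻¹) * (M₂ * ∑ j, ‖b j‖) * A * 1 := by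
    have h1 := inv_etaS_sq_mul i
    calc θ = 32 * ((d : ℝ) + 1) ^ 2 * α₀' * (M₂ * ∑ j, ‖b j‖) * A := hθ
      _ = ((etaS i ^ 2)⁻¹ * (((((ℓ + 1) ^ i.k : ℕ) : ℝ)) ^ 2)⁻¹) * (32 * ((d : ℝ) + 1) ^ 2 * α₀') * (M₂ * ∑ j, ‖b j‖) * A := by rw [h1]; ring
      _ = _ := by ring
  exact hasMajorant_left_conj_GpY_parKnitY_of_parSymY i b ιB hG hGa hU hα hα3 hα2 h52 hM₂ hrepr d' (P := fun a => (geo9K i).len a ^ 2) (Pmax := 1)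
    hA (fun a => sq_nonneg _) (fun a => geo9K_len_sq_le_one i hcf a) hA₁ hW hαδ hαδ' htri hrefl hdnn h261 h263 (etaS_pos i).ne' hθ' hsmall D hGs hD

end Literature.MathematicalPhysics.QuantumFieldTheory.Balaban1983to89.B9B8KnitLetterEntriesTransfer

end
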